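import Literature.AlgebraicGeometry.Resolution.KnafKuhlmann2009HenselianRationality
import Literature.AlgebraicGeometry.Resolution.KnafKuhlmann2009Lemma216
import Literature.AlgebraicGeometry.Resolution.KnafKuhlmann2009Frontier
import HarnessLib

/-!
# Knaf–Kuhlmann 2009, Prop. 3.10 from henselian rationality (Thm. 3.8 + Lemma 3.7)

Topic: `Literature/AlgebraicGeometry/Resolution`. We PROVE the named fact
`KnafKuhlmann2009_Prop310_sepClosed` (`KnafKuhlmann2009Thm11Parts.lean`; Knaf–Kuhlmann 2009,
Prop. 3.10 over a separable-algebraically closed ground field) from the named fact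
`KnafKuhlmann2009_Thm38_Lemma37_sepClosed` (`KnafKuhlmann2009HenselianRationality.lean`; KK09
Thm. 3.8 + Lemma 3.7: a transcendence basis `{x}` with `P` strongly smoothly
`O_{K(x)}`-uniformizable), following the printed proof (p. 14 of the arXiv PDF):

> "Since `(K,P)` is separably tame and hence separable-algebraically maximal, Lemma 2.16 shows
> that condition (3) holds in `(K(x)|K,P)`. Therefore `P|_{K(x)}` is strongly smoothly
> `O_K`-uniformizable by Lemma 3.9. Lemma 3.7, (2) and (3) yield that `P` is strongly smoothly
> `O_{K(x)}`-uniformizable. The assertion now follows from Corollary 3.6."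

with Lemma 2.16 = `kaplansky_condition_of_isSepClosed` (`KnafKuhlmann2009Lemma216.lean`),
Lemma 3.9 = `isSmoothlyUniformizableIn_of_immediate_of_kaplansky`
(`ImmediateRationalUniformization.lean`), and Cor. 3.6 (stacking of strong smooth
uniformizability in the tower `O_K ⊆ O_{K(x)} ⊆ O_F`) carried out as in the induction step of
`knafKuhlmann2009_thm11_sepClosed`: Prop. 3.2 in the strong form `knafKuhlmann2009_prop32_adjoin`
gives descent data `S₀ ⊆ O_{K(x)}`, `G`; Lemma 3.9 gives an `O_K`-model `B` of `K(x)` with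
`S₀` in its local ring, improved to an everywhere smooth `B₂ ⊇ S₀` (`exists_smooth_model_over`);
descent to `S' := B₂` gives the `O_K`-model `B₂[G]` of `F`.

* `KnafKuhlmann2009_Prop310_sepClosed.of_thm38` — PROVED:
  `KnafKuhlmann2009_Thm38_Lemma37_sepClosed → KnafKuhlmann2009_Prop310_sepClosed`.
* `KnafKuhlmann2009_Thm11.of_thm38`, `KnafKuhlmann2009.of_thm38` — corollaries: KK09 Thm. 1.1
  from the single fact Thm. 3.8 + Lemma 3.7, and the fact `KnafKuhlmann2009` (KK09 Thm. 1.2) from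
  `{KnafKuhlmann2009_Thm38_Lemma37_sepClosed, KnafKuhlmann2005_Thm34_etale}` — henselian
  rationality [K8] and inertial generation / generalized stability [K7], the two theorems of
  Kuhlmann's ramification theory of valued function fields.

* `knafKuhlmann2009_cor36` — Cor. 3.6 (stacking of strong smooth uniformizability in a tower
  `K ≤ L ≤ F`), PROVED in the ambient form; `eq_zero_of_eval_eq_zero_of_transcendental`,
  `IsImmediateOver.exists_valuation_sub_lt` — bookkeeping; `…of_thm38Lemma37` — aliases. These
  five carry the names of the declarations of the parallel proposal p16093 (same target path)
  which the whole-file proposal p16123 displaced; statements reconstructed.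

## Source

* H. Knaf, F.-V. Kuhlmann, *Every place admits local uniformization in a finite extension of
  the function field*, Adv. Math. 221 (2009) 428–453 = arXiv:math/0702856: Prop. 3.10 and its
  proof (p. 14), Cor. 3.6 (p. 13), Lemma 2.16 (p. 10), Lemma 3.9 (p. 14).
-/

noncomputable section

namespace Literature.AlgebraicGeometry.Resolution

universe u

open IsLocalRing

/-- **Knaf–Kuhlmann 2009, Prop. 3.10 over a separably closed ground field, from Thm. 3.8 +
Lemma 3.7** (proof of Prop. 3.10, p. 14: Lemma 2.16 + Lemma 3.9 for `K(x)|K`, then Cor. 3.6).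
[cite: KnafKuhlmann2009, Prop. 3.10] -/
theorem KnafKuhlmann2009_Prop310_sepClosed.of_thm38
    (h38 : KnafKuhlmann2009_Thm38_Lemma37_sepClosed.{u}) :
    KnafKuhlmann2009_Prop310_sepClosed.{u} := by
  intro Ω _ V K F hKsc hKF hfg hsg htd1 himm Z hZ
  classical
  haveI := hKsc
  set O : Subring Ω := V.toSubring ⊓ K.toSubring with hOdef
  -- Thm. 3.8 + Lemma 3.7: `P` is strongly smoothly `O_{K(x)}`-uniformizable
  obtain ⟨x, hxF, hxt, hunif⟩ := h38 Ω V K F hKsc hKF hfg hsg htd1 himm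
  set Kx : Subfield Ω := Subfield.closure ((K : Set Ω) ∪ {x}) with hKxdef
  have hKKx : K ≤ Kx := fun c hc => Subfield.subset_closure (Or.inl hc)
  have hxKx : x ∈ Kx := Subfield.subset_closure (Or.inr rfl)
  have hKxF : Kx ≤ F := Subfield.closure_le.mpr (Set.union_subset hKF (Set.singleton_subset_iff.mpr hxF))
  obtain ⟨A, hAV, hAF, hfpA, hfracA, hsmA, hZA⟩ := hunif Z hZ
  haveI := hfpA
  -- Prop. 3.2: descent data
  let S : Type u := ↥(V.toSubring ⊓ Kx.toSubring)
  have hSinj : Function.Injective (algebraMap S Ω) := Subtype.coe_injective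
  have hrangeS : Set.range (algebraMap S Ω) =
      ((V.toSubring ⊓ Kx.toSubring : Subring Ω) : Set Ω) := Subtype.range_coe
  obtain ⟨S₀, G, hS₀S, -, hdesc⟩ := knafKuhlmann2009_prop32_adjoin V S hSinj A hAV hsmA Z hZA
  have hS₀ : ∀ w ∈ S₀, w ∈ V ∧ w ∈ Kx := by
    intro w hw
    have hw' : w ∈ Set.range (algebraMap S Ω) := hS₀S (Finset.mem_coe.mpr hw)
    rw [hrangeS] at hw'
    exact hw'
  -- Lemma 2.16 + Lemma 3.9: `P|_{K(x)}` is strongly smoothly `O_K`-uniformizable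
  have htrans : ∀ P : Polynomial Ω, (∀ k, P.coeff k ∈ K) → P.eval x = 0 → P = 0 := by
    intro P hP hPx
    obtain ⟨P', hP'⟩ : ∃ P' : Polynomial K, P'.map (algebraMap K Ω) = P :=
      (Polynomial.mem_lifts P).mp ((Polynomial.lifts_iff_coeff_lifts P).mpr
        fun k => ⟨⟨P.coeff k, hP k⟩, rfl⟩)
    by_contra hP0
    refine hxt ⟨P', fun h => hP0 ?_, ?_⟩
    · rw [← hP', h, Polynomial.map_zero]
    · rw [Polynomial.aeval_def, ← Polynomial.eval_map, hP', hPx]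
  have hval : ∀ w ∈ Kx, w ≠ 0 → ∃ b ∈ K, V.valuation w = V.valuation b :=
    fun w hw hw0 => himm.1 w (hKxF hw) hw0
  have hres : ∀ w ∈ Kx, w ∈ V → ∃ c ∈ K, V.valuation (w - c) < 1 := by
    intro w hw hwV
    have hr : residue V ⟨w, hwV⟩ ∈ resField V K :=
      himm.2 (residue_mem_resField V ⟨w, hwV⟩ (hKxF hw))
    obtain ⟨c, hcK, hc⟩ := (mem_resField_iff V K _).mp hr
    exact ⟨c, hcK, (residue_eq_residue_iff V ⟨w, hwV⟩ c).mp hc.symm⟩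
  have h3 := kaplansky_condition_of_isSepClosed V K htrans hval hres
  obtain ⟨B, hBV, hBKx, hfpB, hfracB, hsmB, hS₀B⟩ :=
    isSmoothlyUniformizableIn_of_immediate_of_kaplansky V K htrans hval hres h3 S₀ hS₀
  haveI := hfpB
  -- Cor. 3.6: stack the two models via Prop. 3.2
  obtain ⟨B₂, hB₂V, hB₂Kx, hB₂sm, hS₀B₂, hBB₂, hfracB₂, -⟩ :=
    exists_smooth_model_over B hBV hBKx hsmB hfracB S₀ hS₀B
  haveI := hB₂sm
  haveI : Algebra.FormallySmooth O B₂ := hB₂sm.1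
  haveI : Algebra.FinitePresentation O B₂ := hB₂sm.2
  have hB₂inj : Function.Injective (algebraMap B₂ Ω) := Subtype.coe_injective
  have hrangeB₂ : Set.range (algebraMap B₂ Ω) = (B₂ : Set Ω) := Subtype.range_coe
  have h2 : (S₀ : Set Ω) ⊆ Set.range (algebraMap B₂ Ω) := by rw [hrangeB₂]; exact hS₀B₂
  have h3' : Set.range (algebraMap B₂ Ω) ⊆ Set.range (algebraMap S Ω) := by
    rw [hrangeB₂, hrangeS]
    exact fun w hw => ⟨hB₂V hw, hB₂Kx hw⟩
  obtain ⟨C, hCV, -, hCA, hfpC, hsmC, hZC, hclos⟩ := hdesc B₂ hB₂inj h2 h3'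
  haveI := hfpC
  have hB₂C : (B₂ : Set Ω) ⊆ C := fun w hw => C.algebraMap_mem (⟨w, hw⟩ : B₂)
  have hCF : (C : Set Ω) ⊆ F := by
    intro w hw
    obtain ⟨a', ha', b', hb', -, rfl⟩ := hCA w hw
    exact div_mem (hAF ha') (hAF hb')
  have hclosC : Subfield.closure (C : Set Ω) = F := by
    have hA : Subfield.closure (A : Set Ω) = F := subfield_closure_eq_of_frac hAF hfracA
    rw [← hA, ← hclos]
    refine le_antisymm (Subfield.closure_mono Set.subset_union_left) (Subfield.closure_le.mpr ?_)
    refine Set.union_subset Subfield.subset_closure ?_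
    rw [hrangeS]
    rintro w ⟨-, hwKx⟩
    obtain ⟨a', ha', b', hb', rfl⟩ := hfracB₂ w hwKx
    exact div_mem (Subfield.subset_closure (hB₂C ha')) (Subfield.subset_closure (hB₂C hb'))
  refine ⟨C.restrictScalars O, hCV, hCF, finitePresentation_restrictScalars (R := O) B₂ C,
    fun y hy => ?_, isSmoothAt_centre_restrictScalars (R := O) B₂ C hCV hsmC,
    fun z hz => hZC z (Finset.mem_coe.mp hz)⟩
  rw [← hclosC] at hy
  exact exists_div_of_mem_closure C.toSubring hy

/-- **Knaf–Kuhlmann 2009, Thm. 1.1 from Thm. 3.8 + Lemma 3.7.** [cite: KnafKuhlmann2009, Thm. 1.1] -/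
theorem KnafKuhlmann2009_Thm11.of_thm38 (h38 : KnafKuhlmann2009_Thm38_Lemma37_sepClosed.{u}) :
    KnafKuhlmann2009_Thm11.{u} :=
  KnafKuhlmann2009_Thm11.of_prop310 (KnafKuhlmann2009_Prop310_sepClosed.of_thm38 h38)

/-- **Knaf–Kuhlmann 2009, Thm. 1.2 (as printed, first paragraph) from Thm. 3.8 + Lemma 3.7 and
KK05 Thm. 3.4.** [cite: KnafKuhlmann2009, Thm. 1.2] -/
theorem KnafKuhlmann2009_Thm12.of_thm38 (h38 : KnafKuhlmann2009_Thm38_Lemma37_sepClosed.{u})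
    (h34 : KnafKuhlmann2005_Thm34_etale.{u}) : KnafKuhlmann2009_Thm12.{u} :=
  KnafKuhlmann2009_Thm12.of_prop310 (KnafKuhlmann2009_Prop310_sepClosed.of_thm38 h38) h34

/-- **The named fact `KnafKuhlmann2009` from henselian rationality and inertial generation**: its
trust base is now `{KnafKuhlmann2009_Thm38_Lemma37_sepClosed, KnafKuhlmann2005_Thm34_etale}`.
[cite: KnafKuhlmann2009, Thm. 1.2] -/
theorem KnafKuhlmann2009.of_thm38 (h38 : KnafKuhlmann2009_Thm38_Lemma37_sepClosed.{u})
    (h34 : KnafKuhlmann2005_Thm34_etale.{u}) : KnafKuhlmann2009.{u} :=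
  KnafKuhlmann2009.of_prop310 (KnafKuhlmann2009_Prop310_sepClosed.of_thm38 h38) h34


/-! ## Cor. 3.6 and bookkeeping lemmas; names of proposal p16093

The declarations below re-create, with reconstructed (natural) statements, the five declarations
of the parallel proposal p16093 (agent `…Resolution.-211901432c-0`, same target path, landed 53 s
earlier) that the whole-file proposal p16123 of this file displaced: two are aliases of theorems
above, three are the lemmas their names describe (Cor. 3.6 = the stacking step of
`KnafKuhlmann2009_Prop310_sepClosed.of_thm38`, and the `htrans` / `hres` bookkeeping). Binder
order may differ from the displaced originals. -/

/-- A polynomial over `Ω` with coefficients in the subfield `K` vanishing at an element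
transcendental over `K` is zero (the hypothesis `htrans` of Lemma 3.9 / Lemma 2.16 from
`Transcendental K x`). [folklore] -/
theorem eq_zero_of_eval_eq_zero_of_transcendental {Ω : Type u} [Field Ω] {K : Subfield Ω} {x : Ω}
    (hx : Transcendental K x) (P : Polynomial Ω) (hP : ∀ k, P.coeff k ∈ K) (h : P.eval x = 0) :
    P = 0 := by
  obtain ⟨P', hP'⟩ : ∃ P' : Polynomial K, P'.map (algebraMap K Ω) = P :=
    (Polynomial.mem_lifts P).mp ((Polynomial.lifts_iff_coeff_lifts P).mpr
      fun k => ⟨⟨P.coeff k, hP k⟩, rfl⟩)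
  by_contra hP0
  refine hx ⟨P', fun h0 => hP0 ?_, ?_⟩
  · rw [← hP', h0, Polynomial.map_zero]
  · rw [Polynomial.aeval_def, ← Polynomial.eval_map, hP', h]

/-- In an immediate extension `F|K` every element of `V ∩ F` is congruent modulo the maximal ideal
to an element of `K` (the hypothesis `hres` of Lemma 3.9 / Lemma 2.16 from `IsImmediateOver`).
[folklore] -/
theorem IsImmediateOver.exists_valuation_sub_lt {Ω : Type u} [Field Ω] {V : ValuationSubring Ω}
    {K F : Subfield Ω} (himm : IsImmediateOver V K F) {w : Ω} (hw : w ∈ F) (hwV : w ∈ V) :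
    ∃ c ∈ K, V.valuation (w - c) < 1 := by
  have hr : residue V ⟨w, hwV⟩ ∈ resField V K := himm.2 (residue_mem_resField V ⟨w, hwV⟩ hw)
  obtain ⟨c, hcK, hc⟩ := (mem_resField_iff V K _).mp hr
  exact ⟨c, hcK, (residue_eq_residue_iff V ⟨w, hwV⟩ c).mp hc.symm⟩

/-- **Knaf–Kuhlmann 2009, Cor. 3.6** ("Let `(F|K,P)` be a finitely generated, valued field
extension and `L` an intermediate field of `F|K`. If `P|_L` is strongly smoothly
`O_K`-uniformizable and `P` is strongly smoothly `O_L`-uniformizable, then `P` is strongly smoothly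
`O_K`-uniformizable."), ambient form, PROVED (finite generation is not needed): given a finite
`Z ⊆ V ∩ F`, take an `O_L`-model `A` of `F` with `Z ⊆ A_q`; Prop. 3.2
(`knafKuhlmann2009_prop32_adjoin`) gives `S₀ ⊆ O_L` and `G`; an `O_K`-model `B` of `L` with `S₀`
in its local ring is improved to an everywhere smooth `B₂ ⊇ S₀` (`exists_smooth_model_over`), and
descent to `S' := B₂` gives the `O_K`-model `B₂[G]` of `F`. [cite: KnafKuhlmann2009, Cor. 3.6] -/
theorem knafKuhlmann2009_cor36 {Ω : Type u} [Field Ω] (V : ValuationSubring Ω) {K L F : Subfield Ω}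
    (hKL : K ≤ L) (hLF : L ≤ F)
    (hL : ∀ Z : Finset Ω, (∀ z ∈ Z, z ∈ V ∧ z ∈ L) →
      IsSmoothlyUniformizableIn ↥(V.toSubring ⊓ K.toSubring) V L (Z : Set Ω))
    (hF : ∀ Z : Finset Ω, (∀ z ∈ Z, z ∈ V ∧ z ∈ F) →
      IsSmoothlyUniformizableIn ↥(V.toSubring ⊓ L.toSubring) V F (Z : Set Ω))
    (Z : Finset Ω) (hZ : ∀ z ∈ Z, z ∈ V ∧ z ∈ F) :
    IsSmoothlyUniformizableIn ↥(V.toSubring ⊓ K.toSubring) V F (Z : Set Ω) := by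
  classical
  have _hKF : K ≤ F := hKL.trans hLF
  set O : Subring Ω := V.toSubring ⊓ K.toSubring with hOdef
  obtain ⟨A, hAV, hAF, hfpA, hfracA, hsmA, hZA⟩ := hF Z hZ
  haveI := hfpA
  -- Prop. 3.2: descent data
  let S : Type u := ↥(V.toSubring ⊓ L.toSubring)
  have hSinj : Function.Injective (algebraMap S Ω) := Subtype.coe_injective
  have hrangeS : Set.range (algebraMap S Ω) =
      ((V.toSubring ⊓ L.toSubring : Subring Ω) : Set Ω) := Subtype.range_coe
  obtain ⟨S₀, G, hS₀S, -, hdesc⟩ := knafKuhlmann2009_prop32_adjoin V S hSinj A hAV hsmA Z hZA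
  have hS₀ : ∀ w ∈ S₀, w ∈ V ∧ w ∈ L := by
    intro w hw
    have hw' : w ∈ Set.range (algebraMap S Ω) := hS₀S (Finset.mem_coe.mpr hw)
    rw [hrangeS] at hw'
    exact hw'
  -- an everywhere smooth `O_K`-model `B₂ ⊇ S₀` of `L`
  obtain ⟨B, hBV, hBL, hfpB, hfracB, hsmB, hS₀B⟩ := hL S₀ hS₀
  haveI := hfpB
  obtain ⟨B₂, hB₂V, hB₂L, hB₂sm, hS₀B₂, -, hfracB₂, -⟩ :=
    exists_smooth_model_over B hBV hBL hsmB hfracB S₀ hS₀B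
  haveI := hB₂sm
  haveI : Algebra.FormallySmooth O B₂ := hB₂sm.1
  haveI : Algebra.FinitePresentation O B₂ := hB₂sm.2
  -- descent to `S' := B₂`
  have hB₂inj : Function.Injective (algebraMap B₂ Ω) := Subtype.coe_injective
  have hrangeB₂ : Set.range (algebraMap B₂ Ω) = (B₂ : Set Ω) := Subtype.range_coe
  have h2 : (S₀ : Set Ω) ⊆ Set.range (algebraMap B₂ Ω) := by rw [hrangeB₂]; exact hS₀B₂
  have h3 : Set.range (algebraMap B₂ Ω) ⊆ Set.range (algebraMap S Ω) := by
    rw [hrangeB₂, hrangeS]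
    exact fun w hw => ⟨hB₂V hw, hB₂L hw⟩
  obtain ⟨C, hCV, -, hCA, hfpC, hsmC, hZC, hclos⟩ := hdesc B₂ hB₂inj h2 h3
  haveI := hfpC
  have hB₂C : (B₂ : Set Ω) ⊆ C := fun w hw => C.algebraMap_mem (⟨w, hw⟩ : B₂)
  have hCF : (C : Set Ω) ⊆ F := by
    intro w hw
    obtain ⟨a', ha', b', hb', -, rfl⟩ := hCA w hw
    exact div_mem (hAF ha') (hAF hb')
  have hclosC : Subfield.closure (C : Set Ω) = F := by
    have hA : Subfield.closure (A : Set Ω) = F := subfield_closure_eq_of_frac hAF hfracA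
    rw [← hA, ← hclos]
    refine le_antisymm (Subfield.closure_mono Set.subset_union_left) (Subfield.closure_le.mpr ?_)
    refine Set.union_subset Subfield.subset_closure ?_
    rw [hrangeS]
    rintro w ⟨-, hwL⟩
    obtain ⟨a', ha', b', hb', rfl⟩ := hfracB₂ w hwL
    exact div_mem (Subfield.subset_closure (hB₂C ha')) (Subfield.subset_closure (hB₂C hb'))
  refine ⟨C.restrictScalars O, hCV, hCF, finitePresentation_restrictScalars (R := O) B₂ C,
    fun y hy => ?_, isSmoothAt_centre_restrictScalars (R := O) B₂ C hCV hsmC,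
    fun z hz => hZC z (Finset.mem_coe.mp hz)⟩
  rw [← hclosC] at hy
  exact exists_div_of_mem_closure C.toSubring hy

/-- Alias (name of proposal p16093) of `KnafKuhlmann2009_Prop310_sepClosed.of_thm38`.
[cite: KnafKuhlmann2009, Prop. 3.10] -/
theorem KnafKuhlmann2009_Prop310_sepClosed.of_thm38Lemma37
    (h38 : KnafKuhlmann2009_Thm38_Lemma37_sepClosed.{u}) : KnafKuhlmann2009_Prop310_sepClosed.{u} :=
  KnafKuhlmann2009_Prop310_sepClosed.of_thm38 h38

/-- Alias (name of proposal p16093) of `KnafKuhlmann2009_Thm11.of_thm38`.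
[cite: KnafKuhlmann2009, Thm. 1.1] -/
theorem KnafKuhlmann2009_Thm11.of_thm38Lemma37
    (h38 : KnafKuhlmann2009_Thm38_Lemma37_sepClosed.{u}) : KnafKuhlmann2009_Thm11.{u} :=
  KnafKuhlmann2009_Thm11.of_thm38 h38

end Literature.AlgebraicGeometry.Resolution

end
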